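import Summits.ABC.ABC.Theses.DefiniteXi
import Summits.ABC.ABC.Theorems.AbcValuationProduct
import Summits.ABC.ABC.Theorems.DefiniteXiPolyFreyDegree
import Summits.ABC.ABC.Theorems.DefiniteXiPolyDegreeToPolyABC
import Summits.ABC.ABC.Theorems.DefiniteXiXiStrongBoundAllTamExp
import Summits.ABC.ABC.Theorems.DefiniteXiXiStrongBoundSplitCalibration
import Summits.ABC.ABC.Theorems.DefiniteXiXiStrongBoundPrimeCalibration
import Summits.ABC.ABC.Theorems.DefiniteXiXiStrongBoundDegreeCalibration
import Summits.ABC.ABC.Theorems.RibetTakahashiSplitAbcValuationProductSubexp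
import HarnessLib

/-!
# Crux `SteinbergCore` (stmt-ABC-15024), line `p6_tamagawa_split` — THESIS CALIBRATION:
# stub 3 is weak-rung strength, and `SteinbergCore ⟺ FreyDegreeBound` modulo the route's
# abc-free binder and printed comparison theorems

The crux `B = SteinbergCore` of route ABC/DefiniteXi reads, for coprime `a, b` (`ab(a+b) ≠ 0`), `N` the
conductor of `E_(a,b) = freyCurve a b`, every admissible `Nm` and `ξ = brandtXi (N/Nm) Nm (a_n E)`:
`cps ξ · T ≤ C_ε N^(2+ε)`, `cps n = n / (2^{v₂ n} 3^{v₃ n})`, `T = ∏_{q ∣ N} v_q(Δ_min E_(a,b))`.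
Its registered skeleton (line `p6_tamagawa_split`, glue `steinbergCore_of_subs`, p137293) has three stubs:
`stub_xiDegreeComparison` (print, landed modulo facts p137891/p139336), `stub_primeToSixDegreeBound`
(P6, the abc-strength atom) and `stub_abcValuationProduct` (verbatim the open milestone
`Summit.ABC.ABC.Theorems.AbcValuationProduct`, stmt-ABC-1567).

This file records, as citable theorems of the tree (everything below is a composition of LANDED results;
no new definition, no new named fact):

* `abcValuationProduct_of_polyFreyDegree`, `stub_abcValuationProduct_of_polyFreyDegree`,
  `abcValuationProduct_of_freyDegreeBound` — **stub 3 is WEAK-RUNG strength inside this route**: the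
  support item `PolyFreyDegree` (stmt-ABC-2026, polynomial Szpiro on Frey curves in disguise) already gives
  it, through the PROVED item `PolyDegreeToPolyABC` (`polyDegreeToPolyABC_proof`) and the divisor-bound lemma
  `abcValuationProduct_of_polynomialABC`; a fortiori the thesis `FreyDegreeBound` gives it
  (`DefiniteXiPolyFreyDegree.polyFreyDegree_of_freyDegreeBound`).  So the registered stub is not a second
  abc-strength piece of the split (strategist census v3, F1 — there a crux workfile, here a theorem).
* `allTamExp_of_polyFreyDegree` — hence the Frey allowance `T(E_(a,b)) ≤ C_ε N^ε` from the weak rung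
  (`stub_allTamExp_of_valuationProduct`, p87956).
* `steinbergCore_of_freyDegreeBound_of_takahashi` — **`X ⟹ B`**: the thesis `FreyDegreeBound` implies the
  crux, modulo Takahashi 2001 Thm. 2.3 for Shimura curves on the level and discriminant sides (`hTlev`,
  `hT2` — VERBATIM the section hypotheses of `DefiniteXiXiStrongBoundDegreeCalibration` and of the landed
  `xiDegreeComparison_of_facts`, p139336), Pasten's Lemma 6.8 and Jacquet–Langlands data
  (`xiStrongBound_of_freyDegreeBound_of_takahashi`, then `steinbergCore_of_valuationProduct_of_xiStrongBound`
  with the allowance from the first bullet).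
* `freyDegreeBound_of_steinbergCore` — **`B ⟹ X`** given the route's abc-FREE binder
  `EisensteinQuarantine` (stmt-ABC-15023) and the print items `DefiniteRTControlPrime` (stmt-ABC-11338),
  `FreyModularity` (stmt-ABC-11340): the path of the deciding theorem `closes` stopped at the thesis
  (`xiStrongBound_of_eisensteinQuarantine_of_steinbergCore`, `freyDegreeBound_of_xiStrongBound`).
* `steinbergCore_iff_freyDegreeBound_of_takahashi` — **THE CALIBRATION `B ⟺ X`** modulo
  {`EisensteinQuarantine`, `DefiniteRTControlPrime`, `FreyModularity`, `hTlev`, `hT2`, Lemma 6.8, JL data}: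
  relative to the route's own design the crux `SteinbergCore` is EXACTLY thesis-strength (Frey's degree
  conjecture on Frey curves, abc-equivalent by Murty / Pasten), which is the kernel form of the line lead's
  `promote-stub` verdict on `stub_primeToSixDegreeBound` (PromoteStubPrimeToSixDegreeBound.md) and of the
  strategist's F2 (AtomModuloBets.lean): no statement strictly between the weak rung and `X` is isolated by
  the split, and a proof of `B` short of `X` would, composed with bets the route already stakes, prove `X`.
  The lower lock in the other currency (B ⟹ "P6 up to one Tamagawa exponent") is
  `Cruxes/SteinbergCore/Disproof.lean` §C.

## References

* [Takahashi2001] S. Takahashi, Degrees of parametrizations of elliptic curves by Shimura curves,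
  J. Number Theory 90 (2001) 74–88 — Thm. 2.3 (p. 79), Thm. 3.2 (a) (p. 82).
* [PastenShimura2024] H. Pasten, Shimura curves and the abc conjecture, J. Number Theory 254 (2024) 214–335
  = arXiv:1705.09251 — Lemma 6.8 (p. 22), §6.9 (p. 25); Thm. 1.3 (abc ⟹ degree conjecture, S = {2}).
* [MurtyCongruencePrimes1999] M. R. Murty, Bounds for congruence primes, Proc. Sympos. Pure Math. 66.1 (1999)
  177–192 — Thm. 1 (degree conjecture ⟹ abc).
-/

-- `Summit.<Summit>.<Problem>` is the mandated summit-side namespace (CONVENTIONS §2); for the single-conjunct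
-- summit `ABC` the two coincide, so the duplicate `ABC.ABC` is deliberate.
set_option linter.dupNamespace false

noncomputable section

namespace Summit.ABC.ABC.Theorems

open Literature.NumberTheory.EllipticCurves Literature.NumberTheory.EllipticCurves.ModularForms
open Literature.NumberTheory.Automorphic Literature.NumberTheory.DiophantineGeometry
open Summit.ABC.ABC.Theses.DefiniteXi

/-! ## (1) Stub 3 of the split is weak-rung strength -/

/-- **The weak rung gives the valuation-product milestone.** `PolyFreyDegree` (stmt-ABC-2026) implies
`AbcValuationProduct` (stmt-ABC-1567): `PolyDegreeToPolyABC` is proved (`polyDegreeToPolyABC_proof`: Zagier's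
identity, Silverman's covolume inequality, `rad ∣ 2N`), it yields a polynomial abc inequality `c ≤ C rad^κ`,
and any such inequality gives the milestone by the divisor bound (`abcValuationProduct_of_polynomialABC`:
`∏ v_p(abc) ≤ d(abc) ≤ D_η (abc)^η ≤ D_η C^{3η} rad^{3κη}`). [folklore] -/
theorem abcValuationProduct_of_polyFreyDegree (hPF : PolyFreyDegree) : AbcValuationProduct :=
  abcValuationProduct_of_polynomialABC (polyDegreeToPolyABC_proof hPF)

/-- **Stub 3 of line `p6_tamagawa_split` from the weak rung** — the registered signature
`stub_abcValuationProduct` of the skeleton of stmt-ABC-15024, verbatim, under the hypothesis `PolyFreyDegree`.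
[folklore] -/
theorem stub_abcValuationProduct_of_polyFreyDegree : Summit.ABC.ABC.Theses.DefiniteXi.PolyFreyDegree → ∀ ε : ℝ, 0 < ε → ∃ K : ℝ, ∀ a b c : ℕ, Literature.NumberTheory.DiophantineGeometry.IsABCTriple a b c → ((∏ p ∈ (a * b * c).primeFactors, (a * b * c).factorization p : ℕ) : ℝ) ≤ K * ((Literature.NumberTheory.DiophantineGeometry.rad a b c : ℕ) : ℝ) ^ ε :=
  fun hPF => abcValuationProduct_of_polyFreyDegree hPF

/-- **The thesis gives the milestone**: `FreyDegreeBound → AbcValuationProduct`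
(`polyFreyDegree_of_freyDegreeBound`: the thesis at `ε = 1` is the weak rung with `A = 3`). [folklore] -/
theorem abcValuationProduct_of_freyDegreeBound (hX : FreyDegreeBound) : AbcValuationProduct :=
  abcValuationProduct_of_polyFreyDegree (DefiniteXiPolyFreyDegree.polyFreyDegree_of_freyDegreeBound hX)

/-- **The Frey allowance from the weak rung**: `PolyFreyDegree` implies
`T(E_(a,b)) = ∏_{q ∣ N} v_q(Δ_min(E_(a,b))) ≤ C_ε N^ε` for all coprime `a, b` (`ab(a+b) ≠ 0`), `N` the conductor
— the milestone (previous lemma) fed into `stub_allTamExp_of_valuationProduct` (p87956). [folklore] -/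
theorem allTamExp_of_polyFreyDegree (hPF : PolyFreyDegree) :
    ∀ ε : ℝ, 0 < ε → ∃ C : ℝ, ∀ a b : ℤ, IsCoprime a b → a * b * (a + b) ≠ 0 →
      ∀ (N : ℕ) [NeZero N], (freyCurve a b).conductorNorm ℤ = N →
        ((∏ q ∈ N.primeFactors, ((freyCurve a b).minimalDiscriminantNorm ℤ).factorization q : ℕ) : ℝ) ≤
          C * (N : ℝ) ^ ε :=
  stub_allTamExp_of_valuationProduct (abcValuationProduct_of_polyFreyDegree hPF)

/-! ## (2) `B ⟹ X` on the route's abc-free binder and print items -/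

/-- **`SteinbergCore ⟹ FreyDegreeBound`** given `EisensteinQuarantine` (abc-free binder, stmt-ABC-15023),
`DefiniteRTControlPrime` (print, stmt-ABC-11338) and `FreyModularity` (print, stmt-ABC-11340): the two binders
multiply to `XiStrongBound` (`xiStrongBound_of_eisensteinQuarantine_of_steinbergCore`, pure algebra), whose prime
rung with the definite Ribet–Takahashi control bounds every minimal datum and hence gives the thesis
(`freyDegreeBound_of_xiStrongBound`).  This is the deciding theorem `closes` stopped two steps early. [folklore] -/
theorem freyDegreeBound_of_steinbergCore : Summit.ABC.ABC.Theses.DefiniteXi.EisensteinQuarantine → Summit.ABC.ABC.Theses.DefiniteXi.SteinbergCore → Summit.ABC.ABC.Theses.DefiniteXi.DefiniteRTControlPrime → Summit.ABC.ABC.Theses.DefiniteXi.FreyModularity → Summit.ABC.ABC.Theses.DefiniteXi.FreyDegreeBound :=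
  fun hEis hCore hRT hMod =>
    DefiniteXiXiStrongBoundPrimeCalibration.freyDegreeBound_of_xiStrongBound
      (DefiniteXiXiBoundUpgrade.xiStrongBound_of_eisensteinQuarantine_of_steinbergCore hEis hCore) hRT hMod

/-! ## (3) `X ⟹ B` modulo Takahashi's theorem for Shimura curves, Lemma 6.8 and JL data -/

/-- **`FreyDegreeBound ⟹ SteinbergCore`**, modulo Takahashi 2001 Thm. 2.3 for `X₀^D(M)` on the level side
(`hTlev`, Brandt type `(M/p, Dp)`) and on the discriminant side (`hT2`, type `(pM, D/p)`, with Thm. 3.2 (a)),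
Pasten's Lemma 6.8 and the existence of Shimura parametrisation data (Jacquet–Langlands): the thesis gives
`XiStrongBound` at every admissible `Nm` (`xiStrongBound_of_freyDegreeBound_of_takahashi`: Pasten's §6.9
telescoping in Brandt coordinates, loss `163^{ω(Nm)} (∏_{q ∣ Nm} v_q)²`) and the Frey allowance
(`abcValuationProduct_of_freyDegreeBound`), and `XiStrongBound` with the allowance is `SteinbergCore`
(`steinbergCore_of_valuationProduct_of_xiStrongBound`: `cps ξ ≤ ξ ≤ ξ ∏_{q ∣ Nm} v_q`).
[cite: Takahashi2001, Thm. 2.3 (p. 79), Thm. 3.2 (a) (p. 82)] [cite: PastenShimura2024, Lemma 6.8 p. 22, §6.9 p. 25] -/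
theorem steinbergCore_of_freyDegreeBound_of_takahashi : (∀ {N D M p m : ℕ}, p.Prime → M = p * m → ¬ p ∣ m → Literature.NumberTheory.Automorphic.IsAdmissibleFactorization N D M → ∀ (X : Literature.NumberTheory.Automorphic.ShimuraCurveData D M) (W : WeierstrassCurve ℚ) [W.IsElliptic], W.conductorNorm ℤ = N → ∀ (W' : WeierstrassCurve ℚ) [W'.IsElliptic] (P : Literature.NumberTheory.Automorphic.ShimuraParametrizationData X W'), P.IsMinimalFor W → ∀ S : Literature.NumberTheory.Automorphic.Brandt.XiSetup m (D * p), ∃ i j : ℕ, 0 < i ∧ i * j = (W'.minimalDiscriminantNorm ℤ).factorization p ∧ i ∣ S.xi (fun n => W'.LFunction n) ∧ P.deg * i = S.xi (fun n => W'.LFunction n) * j) → (∀ {N D M p d : ℕ}, p.Prime → D = p * d → Literature.NumberTheory.Automorphic.IsAdmissibleFactorization N D M → ∀ (X : Literature.NumberTheory.Automorphic.ShimuraCurveData D M) (W : WeierstrassCurve ℚ) [W.IsElliptic], W.conductorNorm ℤ = N → ∀ (W' : WeierstrassCurve ℚ) [W'.IsElliptic] (P : Literature.NumberTheory.Automorphic.ShimuraParametrizationData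 X W'), P.IsMinimalFor W → ∀ S : Literature.NumberTheory.Automorphic.Brandt.XiSetup (p * M) d, ∃ i j : ℕ, 0 < i ∧ i * j = (W'.minimalDiscriminantNorm ℤ).factorization p ∧ i ∣ S.xi (fun n => W'.LFunction n) ∧ P.deg * i = S.xi (fun n => W'.LFunction n) * j) → Literature.NumberTheory.EllipticCurves.ModularForms.PastenShimura2024_lemma_6_8 → Literature.NumberTheory.Automorphic.nonempty_shimuraParametrizationData → Summit.ABC.ABC.Theses.DefiniteXi.FreyDegreeBound → Summit.ABC.ABC.Theses.DefiniteXi.SteinbergCore :=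
  fun hTlev hT2 h68 hJL hX =>
    DefiniteXiXiStrongBoundSplit.steinbergCore_of_valuationProduct_of_xiStrongBound
      (abcValuationProduct_of_freyDegreeBound hX)
      (DefiniteXiXiStrongBoundDegreeCalibration.xiStrongBound_of_freyDegreeBound_of_takahashi hTlev hT2 h68 hJL hX)

/-! ## (4) The calibration `B ⟺ X` -/

/-- **`SteinbergCore ⟺ FreyDegreeBound`** modulo the route's abc-FREE binder `EisensteinQuarantine`, the print
items `DefiniteRTControlPrime`, `FreyModularity`, and, for `⟸`, Takahashi 2001 Thm. 2.3 for Shimura curves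
(`hTlev`, `hT2`), Pasten's Lemma 6.8 and Jacquet–Langlands data.  Reading for the crux programme: relative to
the route's design the crux stmt-ABC-15024 is EXACTLY thesis-strength — abc on Frey curves — which is the
kernel form of the lead's `promote-stub` verdict on `stub_primeToSixDegreeBound` and of the strategist's F2.
[cite: Takahashi2001, Thm. 2.3 (p. 79), Thm. 3.2 (a) (p. 82)] [cite: PastenShimura2024, Lemma 6.8 p. 22, §6.9 p. 25] -/
theorem steinbergCore_iff_freyDegreeBound_of_takahashi : (∀ {N D M p m : ℕ}, p.Prime → M = p * m → ¬ p ∣ m → Literature.NumberTheory.Automorphic.IsAdmissibleFactorization N D M → ∀ (X : Literature.NumberTheory.Automorphic.ShimuraCurveData D M) (W : WeierstrassCurve ℚ) [W.IsElliptic], W.conductorNorm ℤ = N → ∀ (W' : WeierstrassCurve ℚ) [W'.IsElliptic] (P : Literature.NumberTheory.Automorphic.ShimuraParametrizationData X W'), P.IsMinimalFor W → ∀ S : Literature.NumberTheory.Automorphic.Brandt.XiSetup m (D * p), ∃ i j : ℕ, 0 < i ∧ i * j = (W'.minimalDiscriminantNorm ℤ).factorization p ∧ i ∣ S.xi (fun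 n => W'.LFunction n) ∧ P.deg * i = S.xi (fun n => W'.LFunction n) * j) → (∀ {N D M p d : ℕ}, p.Prime → D = p * d → Literature.NumberTheory.Automorphic.IsAdmissibleFactorization N D M → ∀ (X : Literature.NumberTheory.Automorphic.ShimuraCurveData D M) (W : WeierstrassCurve ℚ) [W.IsElliptic], W.conductorNorm ℤ = N → ∀ (W' : WeierstrassCurve ℚ) [W'.IsElliptic] (P : Literature.NumberTheory.Automorphic.ShimuraParametrizationData X W'), P.IsMinimalFor W → ∀ S : Literature.NumberTheory.Automorphic.Brandt.XiSetup (p * M) d, ∃ i j : ℕ, 0 < i ∧ i * j = (W'.minimalDiscriminantNorm ℤ).factorization p ∧ i ∣ S.xi (fun n => W'.LFunction n) ∧ P.deg * i = S.xi (fun n => W'.LFunction n) * j) → Literature.NumberTheory.EllipticCurves.ModularForms.PastenShimura2024_lemma_6_8 → Literature.NumberTheory.Automorphic.nonempty_shimuraParametrizationData → Summit.ABC.ABC.Theses.DefiniteXi.EisensteinQuarantine → Summit.ABC.ABC.Theses.DefiniteXi.DefiniteRTControlPrime → Summit.ABC.ABC.Theses.DefiniteXi.FreyModularity → (Summit.ABC.ABC.Theses.DefiniteXi.SteinbergCore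 ↔ Summit.ABC.ABC.Theses.DefiniteXi.FreyDegreeBound) :=
  fun hTlev hT2 h68 hJL hEis hRT hMod =>
    ⟨fun hCore => freyDegreeBound_of_steinbergCore hEis hCore hRT hMod,
      steinbergCore_of_freyDegreeBound_of_takahashi hTlev hT2 h68 hJL⟩

end Summit.ABC.ABC.Theorems

end
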